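import Summits.QuantumFields.YangMills.Theorems.BalabanUVNodesN06Rgd2LegAtPinsPhysPUPar

/-!
# BalabanUVNodes ∕ N06 ([B9], `Dag.B9_main`) — R1 J-TWIN (KD‴ LEGS): THE RIGID `rgd2` LETTER (second-order word) AT THE PINS, SITE-TRANSPORTER-PARAMETRIC, ALONG A SUB-FAMILY `f : J → MemberY …` — the J-twin of
# ✓`…N06Rgd2LegAtPinsPhysPUPar.hrgd2_of_pinsP_geo9Y_par` (consumer «KD‴» `…N06AtOpsYSectEStKnitSectDKDR`, which feeds it the MERGED-THRESHOLD (3.49) family `h49m`)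

Track A of `YM-PLAN.md` (cell `pub-ymgap`, HUMAN RULING D-0062), node **N06** = [Balaban1985BackgroundPropagators]; IR-N06-SECTION-2 road **R1** («J-twin of the
producer cone», ★★★ director-ym №524 (3): authorised in principle, STAGED, sibling files only), `R1-JTWIN-SPEC.md` rule (R)′ (dag-n06-d, 2026-08-31): re-key EXACTLY
the section-tainted ∀-member rows along `f`, keep data ∕ pins ∕ laws ∕ section-free rows member-wide, tainted conclusions along `f` ((R).3′).
Seat `pub-ymgap-dag-n06-d` g30 — own-producer twins under «KD‴» (found by the kernel-level dataflow: the leg takes `h49` through the merged family `h49m`, positionally).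

WHAT.  `hrgd2_of_pinsP_geo9Y_par_J` = the parent's theorem with `{J : Type} (f : J → MemberY d ℓ hd hL b₀ b₁ Mstar)` added after the `H` binder and
* TAINTED ROW OF THIS TWIN: `h49` — print's (3.49) majorant for `P` (⟸ (3.48) rows 15∕16 via ✓`…N06Proj349AtPinsPhysRCParJ`), re-keyed `∀ x : MemberY … ↦ ∀ j : J`, read at `f j`;
* LEFT member-wide: Theorem 3.1 `h31`, the pins `hblk12 hblkW12 hGp`, the letter families ∕ pins ∕ laws ∕ instance binders, all x-free numerics ∕ rates ∕ budgets;
* conclusion `∃ M, ∀ j : J, M ≤ (geo9Y (f j)).M → …` along `f` (the per-member hypotheses after `U` stay exactly as in the parent).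
PROOF: the parent's text by generator (`mkJ.py` over the tree bytes): x-free ∃-threshold (member-wide Literature facts); pointwise body `fun x ↦ fun j`, `x ↦ f j`, `h49 x ↦ h49 j`.
HONEST FRAMING.  Bookkeeping over landed objects; every displayed row is a HYPOTHESIS; nothing of [B9] ∕ [4] asserted; COUNT-NEUTRAL (`--supports stmt-QuantumFields-27239
--as helper`); N06 NOT discharged; K1 NOT closed; under R1 the inner-corner question stays DISPLAYED at the K1 face ∕ NODE O join by (α5); nothing continuum ∕ OS ∕
mass gap ∕ Clay.  0 `def`, 0 `sorry`.  NEW file; the parent untouched.  The member-wide parent is the instance `J := MemberY …`, `f := id`; ORPHAN by design until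
«KD‴»ᴶ lands (honest).
[cite: Balaban1985BackgroundPropagators, Thm 3.1 p.394, (3.49) p.398, (3.151)–(3.153) p.426; Balaban1984PropagatorsII, Lemma 2.1 (2.60)–(2.61) p.234]
-/

noncomputable section

namespace Summit.QuantumFields.YangMills.BalabanUVNodes.N06Rgd2LegAtPinsPhysPUParJ

open Literature.MathematicalPhysics.QuantumFieldTheory.Balaban1983to89
open Literature.MathematicalPhysics.QuantumFieldTheory.Balaban1983to89.Node00 (FBondY IBondY SiteY CfgY SiteParY SiteOpY BondParY parBY GpY GpPhysY)
open Literature.MathematicalPhysics.QuantumFieldTheory.Balaban1983to89.Node00.OpsYSectDCoords (DvcoKH DvscoKH RcoK cR39_trBasis_pos)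
open Literature.MathematicalPhysics.QuantumFieldTheory.Balaban1983to89.B9Thm39ReadingCoords (cR39)
open Literature.MathematicalPhysics.QuantumFieldTheory.Balaban1983to89.B9Thm34Ext (toB6)
open Literature.MathematicalPhysics.QuantumFieldTheory.Balaban1983to89.B11SectG (HasMaj BlockNorm RowSum)
open Literature.MathematicalPhysics.QuantumFieldTheory.Balaban1983to89.B9Thm312Whole (cNorm GeoOK)
open Literature.MathematicalPhysics.QuantumFieldTheory.Balaban1983to89.B9Thm312WholeClasses (cNormR)
open Literature.MathematicalPhysics.QuantumFieldTheory.Balaban1983to89.B9RWSums343Holder (HolderProbes)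
open Literature.MathematicalPhysics.QuantumFieldTheory.Balaban1983to89.B9RWSums343to347Whole (Facts347)
open Literature.MathematicalPhysics.QuantumFieldTheory.Balaban1983to89.B9CoReadingCoords (XBK blkBK)
open Literature.MathematicalPhysics.QuantumFieldTheory.Balaban1983to89.B9CoReadingCoordsS (XSK sIK blkSK GcoS)
open Literature.MathematicalPhysics.QuantumFieldTheory.Balaban1983to89.B9CoReadingCoordsH (XHK)
open Literature.MathematicalPhysics.QuantumFieldTheory.Balaban1983to89.B9CoReadingCoordsHolder (PK)
open Literature.MathematicalPhysics.QuantumFieldTheory.Balaban1983to89.B9CoReadingCoordsTranspose (TrIdx trBasis)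
open Literature.MathematicalPhysics.QuantumFieldTheory.Balaban1983to89.B9PinMembersKLevelV1 (MemberY geo9Y)
open Literature.MathematicalPhysics.QuantumFieldTheory.Balaban1983to89.B9BackgroundsKLevelV1R (RegFamY bg9YR MemOfFam)
open Literature.MathematicalPhysics.QuantumFieldTheory.Balaban1983to89.B9GeoLemma21KLevelV1 (geo9Y_len_pos geo9Y_dist_triangle geo9Y_dist_comm)
open Literature.MathematicalPhysics.QuantumFieldTheory.Balaban1983to89.B9GeoNormsKLevelV1 (geo9K geo9K_dist_nonneg)
open Literature.MathematicalPhysics.QuantumFieldTheory.Balaban1983to89.B7Prop2SpecialUnitary (specialUnitaryUnits)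
open Literature.MathematicalPhysics.QuantumFieldTheory.Balaban1983to89.B9PerturbationMajorantAlgebra (Proj349Maj)
open Literature.MathematicalPhysics.QuantumFieldTheory.Balaban1983to89.B9PerturbationMajorantsAtLetters (PcoK rcoK_eq)
open Literature.MathematicalPhysics.QuantumFieldTheory.Balaban1983to89.B9PerturbationMajorantsAtLettersPhys (rcoK_GpPhysY)
open Literature.MathematicalPhysics.QuantumFieldTheory.Balaban1983to89.B9MultiscaleSmoothPartitionYNear (rNear)
open Literature.MathematicalPhysics.QuantumFieldTheory.Balaban1983to89.B9SmoothHolderClassP (bHZKP bHZKPG)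
open Literature.MathematicalPhysics.QuantumFieldTheory.Balaban1983to89.B9GradViaDivLettersTransported (taxiB)
open Literature.MathematicalPhysics.QuantumFieldTheory.Balaban1983to89.B9Thm313WholeCutLettersAtPinsP (wGp_bHZKPG_of_pins)
open Literature.MathematicalPhysics.QuantumFieldTheory.Balaban1983to89.B9RWSums347DefiniteFaces (exp261 facts347_exp261_geo9Y geo9Y_scalars)
open Literature.MathematicalPhysics.QuantumFieldTheory.Balaban1983to89.B9RowSum261DefiniteFaces (rowConst261 rowConst261_nonneg rowConst261_spec_of_rowSum261)
open Literature.MathematicalPhysics.QuantumFieldTheory.Balaban1983to89.B9GeoLemma21KLevelV1 (rowSum261_geo9Y)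
open Literature.MathematicalPhysics.QuantumFieldTheory.Balaban1983to89.B9SectDSup (weightNorm)
open Literature.MathematicalPhysics.QuantumFieldTheory.Balaban1983to89.B6RandomWalkHom (HasMajorantHom)
open Literature.MathematicalPhysics.QuantumFieldTheory.Balaban1983to89.B9Thm313WholeLettersCut (Letters313Zc)
open Literature.MathematicalPhysics.QuantumFieldTheory.Balaban1983to89.B9PerturbationMajorantAlgebra (Thm31GpMaj constA)
open Literature.MathematicalPhysics.QuantumFieldTheory.Balaban1983to89.B9Thm313WholeRgdFrom3152 (Ids3152 rgd2_of_ids3152)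
open Literature.MathematicalPhysics.QuantumFieldTheory.Balaban1983to89.B9Thm312Whole (Identities)
open Literature.MathematicalPhysics.QuantumFieldTheory.Balaban1983to89.B9CoReadingCoordsHolder (blkPK probeK wK w₀K)
open Literature.MathematicalPhysics.QuantumFieldTheory.Balaban1983to89.B9CoReadingCoordsHolderAdm (wKA holderProbesKA)
open Literature.MathematicalPhysics.QuantumFieldTheory.Balaban1983to89.B9LettersHZAtOne (plateau_pos)
open B6GlobalChartV1 (PV blkV1) open B6Ineq2142KLevelV1 (β lvl) open B6Geom246MultiLevelTorus (geomT)
open scoped Matrix.Norms.L2Operator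

variable {N : ℕ} {d ℓ : ℕ} {hd : 1 ≤ d + 1} {hL : Odd (ℓ + 1) ∧ 1 < ℓ + 1} {b₀ b₁ : ℝ} {Mstar : ℕ}

/-- ★★ **`rgd2` OVER A TRANSPORTER PARAMETER `parS`** (module docstring): `hrgd2_of_pinsP_geo9Y` with the pins `parS x = parSymY`, `Gp x = GpY parSymY` removed —
`Gp x = GpY (parS x)`, `R` read at `(parS x, GpPhysY (parS x))`, the member-wise (3.152) at `GcoS … (GpY (parS x))`; threshold `M` above which the letter holds at `(B₃, δ₃)`
for every member. [cite: Balaban1985BackgroundPropagators, (3.152)–(3.153) p.426 + Thm 3.1 (3.42) p.397 + (3.49) p.399 + Thm 3.13 p.426, (3.19) p.393; Balaban1984PropagatorsII, (2.52)–(2.56) pp.232–233 + Lemma 2.1 (2.60)–(2.61) p.234] -/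
theorem hrgd2_of_pinsP_geo9Y_par_J [NeZero N] [∀ x : MemberY d ℓ hd hL b₀ b₁ Mstar, Fintype (geo9Y x).Site]
    {R₁ R₂ : RegFamY d ℓ hd hL b₀ b₁ Mstar (Matrix (Fin N) (Fin N) ℂ)} (H : MemberY d ℓ hd hL b₀ b₁ Mstar → Prop) {J : Type} (f : J → MemberY d ℓ hd hL b₀ b₁ Mstar)
    (bI : ∀ x : MemberY d ℓ hd hL b₀ b₁ Mstar, FBondY x.toKIdx → IBondY x.toKIdx)
    (parS : ∀ x : MemberY d ℓ hd hL b₀ b₁ Mstar, SiteParY (Matrix (Fin N) (Fin N) ℂ) x.toKIdx) {Gp : ∀ x : MemberY d ℓ hd hL b₀ b₁ Mstar, SiteOpY (Matrix (Fin N) (Fin N) ℂ) x.toKIdx}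
    (c : ℝ) {M₀ a₀ : ℝ} {αW σW δFW : ℝ} (hαW0 : 0 < αW) (hαW1 : αW < 1) (hσW : 0 < σW) (hδFW : 0 < δFW)
    (𝔬12 : ∀ x : MemberY d ℓ hd hL b₀ b₁ Mstar, B9Thm312Whole.Ops (geo9Y x) (bg9YR (Matrix (Fin N) (Fin N) ℂ) (specialUnitaryUnits (Fin N)) R₁ R₂ x) (XBK (TrIdx N) x.toKIdx) (XBK (TrIdx N) x.toKIdx) (XHK (TrIdx N) x.toKIdx) (XSK (TrIdx N) x.toKIdx))
    (hblk12 : ∀ x : MemberY d ℓ hd hL b₀ b₁ Mstar, (𝔬12 x).blk = blkBK x.toKIdx (bI x))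
    (hblkW12 : ∀ x : MemberY d ℓ hd hL b₀ b₁ Mstar, (𝔬12 x).blkW = blkSK x.toKIdx (sIK x.toKIdx (bI x)))
    (hDvco12 : ∀ (x : MemberY d ℓ hd hL b₀ b₁ Mstar) (U : (bg9YR (Matrix (Fin N) (Fin N) ℂ) (specialUnitaryUnits (Fin N)) R₁ R₂ x).Cfg), (𝔬12 x).Dv U = DvcoKH x.toKIdx (trBasis N) (bg9YR (Matrix (Fin N) (Fin N) ℂ) (specialUnitaryUnits (Fin N)) R₁ R₂ x) (fun U => U) U)
    (hDvsco12 : ∀ (x : MemberY d ℓ hd hL b₀ b₁ Mstar) (U : (bg9YR (Matrix (Fin N) (Fin N) ℂ) (specialUnitaryUnits (Fin N)) R₁ R₂ x).Cfg), (𝔬12 x).Dvstar U = DvscoKH x.toKIdx (trBasis N) (bg9YR (Matrix (Fin N) (Fin N) ℂ) (specialUnitaryUnits (Fin N)) R₁ R₂ x) (fun U => U) U)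
    (hRco12 : ∀ (x : MemberY d ℓ hd hL b₀ b₁ Mstar) (U : (bg9YR (Matrix (Fin N) (Fin N) ℂ) (specialUnitaryUnits (Fin N)) R₁ R₂ x).Cfg), (𝔬12 x).R U = RcoK x.toKIdx (trBasis N) (bg9YR (Matrix (Fin N) (Fin N) ℂ) (specialUnitaryUnits (Fin N)) R₁ R₂ x) (fun U => U) (parS x) (GpPhysY x.toKIdx (parS x)) U)
    {B₃ δ₃ : ℝ}
    {B₀ δ₀ CP δP : ℝ} (hB₀ : 0 ≤ B₀) (hCP : 0 ≤ CP)
    (hδ₀ : δFW ≤ δ₀) (hδP : δFW ≤ δP) (hbud : 0 ≤ δFW - αW * δFW - 2 * σW)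
    (hB₃r : constA (cR39 (trBasis N))⁻¹ B₀ CP (rowConst261 (@geo9Y d ℓ hd hL b₀ b₁ Mstar) σW) (((ℓ + 1 : ℕ) : ℝ)) ≤ B₃) (hδ₃w : δ₃ ≤ δFW - αW * δFW - 2 * σW)
    (hGp : ∀ x : MemberY d ℓ hd hL b₀ b₁ Mstar, Gp x = GpY x.toKIdx (parS x))
    (h31 : ∀ x : MemberY d ℓ hd hL b₀ b₁ Mstar, M₀ ≤ (geo9Y x).M → ∀ α₀ : ℝ, 0 < α₀ → (geo9Y x).M * α₀ ≤ a₀ → ∀ U : (bg9YR (Matrix (Fin N) (Fin N) ℂ) (specialUnitaryUnits (Fin N)) R₁ R₂ x).Cfg, (bg9YR (Matrix (Fin N) (Fin N) ℂ) (specialUnitaryUnits (Fin N)) R₁ R₂ x).Reg335 c α₀ U →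
      Thm31GpMaj (g := geo9Y x) (blkSK x.toKIdx (sIK x.toKIdx (bI x))) (blkBK x.toKIdx (bI x))
        (GcoS x.toKIdx (trBasis N) (bg9YR (Matrix (Fin N) (Fin N) ℂ) (specialUnitaryUnits (Fin N)) R₁ R₂ x) (fun U => U) (Gp x) U)
        (DvcoKH x.toKIdx (trBasis N) (bg9YR (Matrix (Fin N) (Fin N) ℂ) (specialUnitaryUnits (Fin N)) R₁ R₂ x) (fun U => U) U) (DvscoKH x.toKIdx (trBasis N) (bg9YR (Matrix (Fin N) (Fin N) ℂ) (specialUnitaryUnits (Fin N)) R₁ R₂ x) (fun U => U) U) 1 (H x) B₀ δ₀)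
    (h49 : ∀ j : J, M₀ ≤ (geo9Y (f j)).M → ∀ α₀ : ℝ, 0 < α₀ → (geo9Y (f j)).M * α₀ ≤ a₀ → ∀ U : (bg9YR (Matrix (Fin N) (Fin N) ℂ) (specialUnitaryUnits (Fin N)) R₁ R₂ (f j)).Cfg, (bg9YR (Matrix (Fin N) (Fin N) ℂ) (specialUnitaryUnits (Fin N)) R₁ R₂ (f j)).Reg335 c α₀ U →
      Proj349Maj (g := geo9Y (f j)) (blkSK (f j).toKIdx (sIK (f j).toKIdx (bI (f j)))) (blkBK (f j).toKIdx (bI (f j)))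
        (PcoK (f j).toKIdx (trBasis N) (bg9YR (Matrix (Fin N) (Fin N) ℂ) (specialUnitaryUnits (Fin N)) R₁ R₂ (f j)) (fun U => U) (parS (f j)) (Gp (f j)) U)
        (DvcoKH (f j).toKIdx (trBasis N) (bg9YR (Matrix (Fin N) (Fin N) ℂ) (specialUnitaryUnits (Fin N)) R₁ R₂ (f j)) (fun U => U) U) (DvscoKH (f j).toKIdx (trBasis N) (bg9YR (Matrix (Fin N) (Fin N) ℂ) (specialUnitaryUnits (Fin N)) R₁ R₂ (f j)) (fun U => U) U) 1 (H (f j)) CP δP) :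
    ∃ M13 : ℝ, ∀ j : J, letI : Fintype (geo9K (f j).toKIdx).Site := (inferInstance : Fintype (geo9Y (f j)).Site); M13 ≤ (geo9Y (f j)).M → ∀ α₀ : ℝ, 0 < α₀ → (geo9Y (f j)).M * α₀ ≤ a₀ → ∀ U : (bg9YR (Matrix (Fin N) (Fin N) ℂ) (specialUnitaryUnits (Fin N)) R₁ R₂ (f j)).Cfg, (bg9YR (Matrix (Fin N) (Fin N) ℂ) (specialUnitaryUnits (Fin N)) R₁ R₂ (f j)).Reg335 c α₀ U →
      (bg9YR (Matrix (Fin N) (Fin N) ℂ) (specialUnitaryUnits (Fin N)) R₁ R₂ (f j)).Reg336 c α₀ U → Ids3152 (𝔬12 (f j)) (GcoS (f j).toKIdx (trBasis N) (bg9YR (Matrix (Fin N) (Fin N) ℂ) (specialUnitaryUnits (Fin N)) R₁ R₂ (f j)) (fun U => U) (GpY (f j).toKIdx (parS (f j)))) U →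
        HasMaj (cNorm 1 (H (f j)) (𝔬12 (f j)).blk (fun y => (geo9Y_len_pos (f j) y).le) 0) (cNorm 1 (H (f j)) (𝔬12 (f j)).blkW (fun y => (geo9Y_len_pos (f j) y).le) 1)
          ((𝔬12 (f j)).R U ∘ₗ (𝔬12 (f j)).Dvstar U ∘ₗ (𝔬12 (f j)).G1 U ∘ₗ LinearMap.id) (fun a b => B₃ * Real.exp (-(δ₃ * (geo9Y (f j)).dist a b))) := by
  obtain ⟨Mg, hFa⟩ := facts347_exp261_geo9Y (d := d) (ℓ := ℓ) (hd := hd) (hL := hL) (b₀ := b₀) (b₁ := b₁) (Mstar := Mstar) H hαW0 hαW1 hδFW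
  obtain ⟨ML, hrow⟩ := rowConst261_spec_of_rowSum261 (rowSum261_geo9Y (d := d) (ℓ := ℓ) (hd := hd) (hL := hL) (b₀ := b₀) (b₁ := b₁) (Mstar := Mstar)) hσW
  have hc0 : (0 : ℝ) ≤ rowConst261 (@geo9Y d ℓ hd hL b₀ b₁ Mstar) σW := rowConst261_nonneg _ _
  have hαδ : 0 ≤ αW * δFW := (mul_pos hαW0 hδFW).le
  refine ⟨max M₀ (max Mg ML), fun j hM α₀ hα ha U hU hU' h152x => ?_⟩
  letI : Fintype (geo9K (f j).toKIdx).Site := (inferInstance : Fintype (geo9Y (f j)).Site)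
  have hM0 : M₀ ≤ (geo9Y (f j)).M := (le_max_left _ _).trans hM
  have hrowx : RowSum (toB6 (geo9Y (f j)) 1 (H (f j))) σW (rowConst261 (@geo9Y d ℓ hd hL b₀ b₁ Mstar) σW) := fun y => hrow (f j) (((le_max_right _ _).trans (le_max_right _ _)).trans hM) y
  have hFax := hFa (f j) (((le_max_left _ _).trans (le_max_right _ _)).trans hM)
  have hG : GeoOK (geo9Y (f j)) := ⟨geo9Y_dist_triangle (f j), geo9Y_dist_comm (f j), geo9K_dist_nonneg (f j).toKIdx, geo9Y_len_pos (f j)⟩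
  have hN : 0 < N := Nat.pos_of_ne_zero (NeZero.ne N)
  have hϱ : 0 ≤ (cR39 (trBasis N))⁻¹ := inv_nonneg.2 (cR39_trBasis_pos hN).le
  have hR : (𝔬12 (f j)).R U = (cR39 (trBasis N))⁻¹ • (LinearMap.id -
      PcoK (f j).toKIdx (trBasis N) (bg9YR (Matrix (Fin N) (Fin N) ℂ) (specialUnitaryUnits (Fin N)) R₁ R₂ (f j)) (fun U => U) (parS (f j)) (GpY (f j).toKIdx (parS (f j))) U) := by
    rw [hRco12 (f j) U, rcoK_GpPhysY, rcoK_eq]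
  have h49' : Proj349Maj (𝔬12 (f j)).blkW (𝔬12 (f j)).blk
      (PcoK (f j).toKIdx (trBasis N) (bg9YR (Matrix (Fin N) (Fin N) ℂ) (specialUnitaryUnits (Fin N)) R₁ R₂ (f j)) (fun U => U) (parS (f j)) (GpY (f j).toKIdx (parS (f j))) U)
      ((𝔬12 (f j)).Dv U) ((𝔬12 (f j)).Dvstar U) 1 (H (f j)) CP δP := by
    rw [hblkW12 (f j), hblk12 (f j), hDvco12 (f j) U, hDvsco12 (f j) U, ← hGp (f j)]
    exact h49 j hM0 α₀ hα ha U hU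
  have h31' : Thm31GpMaj (𝔬12 (f j)).blkW (𝔬12 (f j)).blk (GcoS (f j).toKIdx (trBasis N) (bg9YR (Matrix (Fin N) (Fin N) ℂ) (specialUnitaryUnits (Fin N)) R₁ R₂ (f j)) (fun U => U) (GpY (f j).toKIdx (parS (f j))) U) ((𝔬12 (f j)).Dv U) ((𝔬12 (f j)).Dvstar U) 1 (H (f j)) B₀ δ₀ := by
    rw [hblkW12 (f j), hblk12 (f j), hDvco12 (f j) U, hDvsco12 (f j) U, ← hGp (f j)]
    exact h31 (f j) hM0 α₀ hα ha U hU
  -- `rgd2 = R∘G′∘D*` by the printed identity (3.152), Theorem 3.1 (`h31`) and (3.49) (`h49`): dag-n06-l g16 `rgd2_of_ids3152`, the member's `L ≤ ℓ+1` moved into `constA`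
  have hLx : (geo9Y (f j)).L ≤ (((ℓ + 1 : ℕ) : ℝ)) := (geo9Y_scalars (f j)).2.1
  have hL0 : 0 ≤ (geo9Y (f j)).L := le_trans zero_le_one hFax.one_le_L
  have hmono : constA (cR39 (trBasis N))⁻¹ B₀ CP (rowConst261 (@geo9Y d ℓ hd hL b₀ b₁ Mstar) σW) (geo9Y (f j)).L ≤
      constA (cR39 (trBasis N))⁻¹ B₀ CP (rowConst261 (@geo9Y d ℓ hd hL b₀ b₁ Mstar) σW) (((ℓ + 1 : ℕ) : ℝ)) := by
    unfold constA
    have h2 : (geo9Y (f j)).L ^ 2 ≤ (((ℓ + 1 : ℕ) : ℝ)) ^ 2 := pow_le_pow_left₀ hL0 hLx 2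
    have h3 : (geo9Y (f j)).L ^ 2 * CP * rowConst261 (@geo9Y d ℓ hd hL b₀ b₁ Mstar) σW ≤ (((ℓ + 1 : ℕ) : ℝ)) ^ 2 * CP * rowConst261 (@geo9Y d ℓ hd hL b₀ b₁ Mstar) σW :=
      mul_le_mul_of_nonneg_right (mul_le_mul_of_nonneg_right h2 hCP) hc0
    exact mul_le_mul_of_nonneg_left (by linarith) (mul_nonneg hϱ hB₀)
  exact rgd2_of_ids3152 hG hFax hrowx h31' h49' hR h152x hϱ hB₀ hCP hc0 hσW.le hαδ hδ₀ hδP (by linarith [hσW.le]) (hmono.trans hB₃r) (by linarith [hσW.le])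

end Summit.QuantumFields.YangMills.BalabanUVNodes.N06Rgd2LegAtPinsPhysPUParJ

end
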